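import Literature.MathematicalPhysics.QuantumFieldTheory.Balaban1983to89.B6Ineq243TwoLevelBox
import Literature.MathematicalPhysics.QuantumFieldTheory.Balaban1983to89.B6Partition236TwoLevelBox
import Literature.MathematicalPhysics.QuantumFieldTheory.Balaban1983to89.B6Eq250

/-!
# `Balaban1983to89.B6Eq238TwoLevelBox` — [B6] (2.37)–(2.38) `G′₀ = Σ_□ h_□G′(□)h_□`, `Δ′_aG′₀ = I − Σ_□ K(h_□)G′(□)h_□ = I − R`
FOR THE GENUINE TWO-LEVEL OPERATOR `Δ_Ω^{L^{−j},N} + Q′*aQ′` ON A BOX OF `L`-BLOCKS, with the printed (1.118) cut-offs and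
the genuine cube propagators `G′(□) = B6Ineq243TwoLevelBox.gTwoLevel` of the cut cubes (file 2/3 of the two-level
parametrix; no existing module is touched; no fact is minted)

FRAMING (verbatim cell line):
statement-level skeleton of published theorems with citation tags; proofs where landed; nothing here is a claim about the Yang–Mills mass gap

Source under audit (cell pub-balaban): T. Bałaban, *Propagators and renormalization transformations for lattice gauge
theories. II*, Commun. Math. Phys. **96** (1984) 223–250 [`Balaban1984PropagatorsII`, "B6"], p. 229 [PDF 7] (2.36)–(2.39),
p. 230 [PDF 8] (2.40)–(2.44) (renders `b2b-balaban-ref1/pages/1984-cmp96-propagators-rt-II/…-p007-x2.png`, `…-p008-x2.png`,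
read as images this generation); T. Bałaban, *Regularity and decay of lattice Green's functions*, Commun. Math. Phys. **89**
(1983) 571–597 [`Balaban1983RegularityDecay`, "[3]"], §2 pp. 575–576 (the cubes `□_j = Ω ∩ {…}`, (2.2), (2.6)).

## WHAT IS PRINTED (p. 229, verbatim up to notation)

«Now let us define G′₀ = Σ_{□∈𝒟} h_□G′(□)h_□, (2.37) where G′(□) is an inverse of the operator Δ′_a with some boundary
conditions on the boundary of □, e.g. … with Neumann boundary conditions … We have
Δ′_aG′₀ = I − Σ_□ K(h_□)G′(□)h_□ = I − R, (2.38) where [K(h) is the explicit operator (2.39)]».  [3] p. 576, (2.6):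
«(−Δ^{η,N}_{A,Ω})h_jG(□_j, A_j) = (−Δ^{η,N}_{A_j,□_j})h_jG(□_j, A_j), because the function h_j can be ≠ 0 only on the part
of the boundary of □_j which is contained in the boundary of Ω.»

## WHAT THIS FILE CERTIFIES (kernel-checked; `A = 0`; the lineage is USED, not re-proved)

Setting (units of `B6Ineq243TwoLevelBox`): `L = ℓ + 1 ≥ 2`, `n = L^k` fine sites per unit block (mesh `L^{−j}`, `k ≥ 1`),
cube half-width `M = L·M_h` unit blocks, `N = nM`; the big box `Ω = Π_μ[0, N·P_μ)` of `L`-blocks (`M′_Ω = M_h·P`),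
`Λ ⊆ Ω^{(j)}` a union of `L`-blocks; `E := twoLevelOp n ℓ a_j a m² (M_h·P) Λ` THE GENUINE TWO-LEVEL OPERATOR ON `Ω`;
the cut cubes `□_q` (`q ∈ Π[0,P_μ]`, `B6Partition236TwoLevelBox.cubeLo/cubeW`) embedded by `B4SubBoxCarrier.subEmb`
(`emb`), each carrying its own two-level operator `E_q := twoLevelOp n ℓ a_j a m² (M_h·cubeW) Λ_q` (`Λ_q` = the part
of `Λ` in `□_q`, a union of `L`-blocks, `isBlockUnion_lamLoc`) and its propagator `G′(□_q) := gTwoLevel …`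
(`E_qG′(□_q) = 1`, `B6Ineq243TwoLevelBox.twoLevelOp_mul_gTwoLevel`); `h_q = B6Partition236TwoLevelBox.hq` on `Ω`.
* §1 `res e` — restriction to a sub-box as a `0/1` matrix, `res·resᵀ = 1`, padding `resᵀ·B·res`, and how diagonal
  (multiplication) operators pass through (`diagonal_mul_transpose_res`, `res_mul_diagonal`).
* §3 **LOCALISATION = [3] (2.6) for the two-level operator**: a site of `□_q` off the INTERNAL boundary layer `IL` has
  all its `Ω`-neighbours and its `L`-block inside `□_q` (`exists_emb_eq_of_nbr`, `exists_emb_eq_of_blkL`), so the row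
  of `E` at such a site IS the (padded) row of `E_q` (`row_eq_pad_row`); hence `diagonal h·E = diagonal h·resᵀE_q res` for
  every `h` supported off `IL` (`diagonal_mul_eq_pad`), in particular for `h_q` (`hΩ_support`).
* §5 **(2.37)–(2.38)**: with `h_q ↦ diagonal h_q`, `G′(□_q) ↦ resᵀ·gTwoLevel·res` in the matrix ring of `Ω`:
  `sum_hDiag_sq` (= (2.36), `Σ_q h_q² = 1`), `hloc_cube` (`h_qE G′(□_q)h_q = h_q²`), **`eq238_twoLevelBox`**:
  `E·G′₀ = 1 − R`, `G′₀ = B6Eq250.gZero`, `R = B6Eq250.rOp` (the abstract (2.38) `B6Eq250.eq238` with every hypothesis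
  DISCHARGED for the genuine objects), and **`bTerm_eq_pad`**: each term of `R` is the padded LOCAL operator
  `resᵀ·(K_q(h_q)G′(□_q)h_q)·res`, `K_q(h) = B6Ineq243TwoLevelBox.kComm E_q h` — the object bounded by (2.44)
  (`B6Ineq243TwoLevelBox.ineq244_twoLevel`; the bound (2.49) and the series (2.50) are file 3/3).

## HONEST SCOPE

`k = 1` (two levels `j`, `j + 1`), `A = 0`, a box `Ω` with Neumann conditions in place of the torus, ONE cube size `2M`
(unit blocks) for the whole cover (cf. `B6Partition236TwoLevelBox`); `m² ≥ 0` a free parameter; constants irrelevant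
here (pure algebra and lattice geometry).  Nothing is inferred from the manuscript: every step is kernel-checked.
-/

namespace Literature.MathematicalPhysics.QuantumFieldTheory.Balaban1983to89.B6Eq238TwoLevelBox

open Finset Matrix
open Literature.MathematicalPhysics.QuantumFieldTheory.Balaban1983to89.B4Reflection242 (boxDom mem_boxDom nbrs mem_nbrs
  blk blk_mem_boxDom neumannLapK diagK avgK)
open Literature.MathematicalPhysics.QuantumFieldTheory.Balaban1983to89.B4Green242Bridge (boxNbrs)
open Literature.MathematicalPhysics.QuantumFieldTheory.Balaban1983to89.B4BoxCov237 (boxOpR boxOpR_isSymm blockAvgP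
  blockAvgP_isSymm)
open Literature.MathematicalPhysics.QuantumFieldTheory.Balaban1983to89.B4Lemma22ReduceZero (Box)
open Literature.MathematicalPhysics.QuantumFieldTheory.Balaban1983to89.B4SubBoxCarrier
open Literature.MathematicalPhysics.QuantumFieldTheory.Balaban1983to89.B4TwoBox120 (blk_add_mul)
open Literature.MathematicalPhysics.QuantumFieldTheory.Balaban1983to89.B6Ineq243TwoLevelBox
open Literature.MathematicalPhysics.QuantumFieldTheory.Balaban1983to89.B6Partition236TwoLevelBox

noncomputable section

variable {d : ℕ}

/-! ## §1 Restriction to a sub-box and padding, as matrices -/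

section Res

variable {X X' Y : Type*} [Fintype X] [Fintype X'] [DecidableEq X] [DecidableEq X']

/-- the RESTRICTION along an embedding `e : X′ ↪ X` as a `0/1` matrix: `res e (a, x) = [e a = x]`; `resᵀ` is the
extension by zero («ω is equal to 0 beyond Λ»-type padding). [cite: Balaban1983RegularityDecay, §2 p.575 («□_j = Ω ∩ {…}»), dictionary] -/
def res (e : X' → X) : Matrix X' X ℝ := Matrix.of fun a x => if e a = x then 1 else 0

omit [Fintype X] [Fintype X'] [DecidableEq X'] in
/-- entries of `res`. [cite: Balaban1983RegularityDecay, §2 p.575, dictionary] -/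
theorem res_apply (e : X' → X) (a : X') (x : X) : res e a x = if e a = x then 1 else 0 := rfl

omit [Fintype X] [DecidableEq X'] in
/-- a row of `resᵀ·B` on the image is the row of `B`. [cite: Balaban1983RegularityDecay, §2 p.575, dictionary] -/
theorem transpose_res_mul_apply_img {e : X' → X} (he : Function.Injective e) (B : Matrix X' Y ℝ) (a : X') (y : Y) :
    ((res e)ᵀ * B) (e a) y = B a y := by
  rw [Matrix.mul_apply, Finset.sum_eq_single a]
  · rw [Matrix.transpose_apply, res_apply, if_pos rfl, one_mul]
  · intro a' _ ha'
    rw [Matrix.transpose_apply, res_apply, if_neg (fun h => ha' (he h)), zero_mul]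
  · intro h; exact absurd (Finset.mem_univ a) h

omit [Fintype X] [DecidableEq X'] in
/-- a row of `resᵀ·B` off the image vanishes. [cite: Balaban1983RegularityDecay, §2 p.575, dictionary] -/
theorem transpose_res_mul_apply_off (e : X' → X) (B : Matrix X' Y ℝ) {x : X} (hx : ∀ a, e a ≠ x) (y : Y) :
    ((res e)ᵀ * B) x y = 0 := by
  rw [Matrix.mul_apply]
  exact Finset.sum_eq_zero fun a _ => by rw [Matrix.transpose_apply, res_apply, if_neg (hx a), zero_mul]

omit [Fintype X] [DecidableEq X'] in
/-- a column of `C·res` on the image is the column of `C`. [cite: Balaban1983RegularityDecay, §2 p.575, dictionary] -/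
theorem mul_res_apply_img {e : X' → X} (he : Function.Injective e) (C : Matrix Y X' ℝ) (y : Y) (b : X') :
    (C * res e) y (e b) = C y b := by
  rw [Matrix.mul_apply, Finset.sum_eq_single b]
  · rw [res_apply, if_pos rfl, mul_one]
  · intro b' _ hb'
    rw [res_apply, if_neg (fun h => hb' (he h)), mul_zero]
  · intro h; exact absurd (Finset.mem_univ b) h

omit [Fintype X] [DecidableEq X'] in
/-- a column of `C·res` off the image vanishes. [cite: Balaban1983RegularityDecay, §2 p.575, dictionary] -/
theorem mul_res_apply_off (e : X' → X) (C : Matrix Y X' ℝ) (y : Y) {x : X} (hx : ∀ a, e a ≠ x) :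
    (C * res e) y x = 0 := by
  rw [Matrix.mul_apply]
  exact Finset.sum_eq_zero fun b _ => by rw [res_apply, if_neg (hx b), mul_zero]

omit [Fintype X'] [DecidableEq X'] in
/-- restriction of a vector: `(res·v)(a) = v(e a)`. [cite: Balaban1983RegularityDecay, §2 p.575, dictionary] -/
theorem res_mulVec (e : X' → X) (v : X → ℝ) (a : X') : (res e *ᵥ v) a = v (e a) := by
  rw [Matrix.mulVec, dotProduct, Finset.sum_eq_single (e a)]
  · rw [res_apply, if_pos rfl, one_mul]
  · intro x _ hx; rw [res_apply, if_neg (Ne.symm hx), zero_mul]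
  · intro h; exact absurd (Finset.mem_univ _) h

omit [Fintype X] [DecidableEq X'] in
/-- extension by zero, on the image: `(resᵀ·u)(e a) = u(a)`. [cite: Balaban1983RegularityDecay, §2 p.575, dictionary] -/
theorem transpose_res_mulVec_img {e : X' → X} (he : Function.Injective e) (u : X' → ℝ) (a : X') :
    ((res e)ᵀ *ᵥ u) (e a) = u a := by
  rw [Matrix.mulVec, dotProduct, Finset.sum_eq_single a]
  · rw [Matrix.transpose_apply, res_apply, if_pos rfl, one_mul]
  · intro a' _ ha'; rw [Matrix.transpose_apply, res_apply, if_neg (fun h => ha' (he h)), zero_mul]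
  · intro h; exact absurd (Finset.mem_univ _) h

omit [Fintype X] [DecidableEq X'] in
/-- extension by zero, off the image: `(resᵀ·u)(x) = 0`. [cite: Balaban1983RegularityDecay, §2 p.575, dictionary] -/
theorem transpose_res_mulVec_off (e : X' → X) (u : X' → ℝ) {x : X} (hx : ∀ a, e a ≠ x) :
    ((res e)ᵀ *ᵥ u) x = 0 := by
  rw [Matrix.mulVec, dotProduct]
  exact Finset.sum_eq_zero fun a _ => by rw [Matrix.transpose_apply, res_apply, if_neg (hx a), zero_mul]

omit [Fintype X'] in
/-- `res·resᵀ = 1` (restriction after extension is the identity). [cite: Balaban1983RegularityDecay, §2 p.575, dictionary] -/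
theorem res_mul_transpose_res {e : X' → X} (he : Function.Injective e) : res e * (res e)ᵀ = 1 := by
  ext a b
  rw [mul_res_apply_img' he]
  where
  /-- helper: `(res e * resᵀ) a b = δ_{ab}` -/
  mul_res_apply_img' {e : X' → X} (he : Function.Injective e) (a b : X') :
      (res e * (res e)ᵀ) a b = (1 : Matrix X' X' ℝ) a b := by
    rw [Matrix.mul_apply, Finset.sum_eq_single (e b)]
    · rw [Matrix.transpose_apply, res_apply, res_apply, if_pos rfl, mul_one, Matrix.one_apply]
      by_cases hab : a = b
      · subst hab; rw [if_pos rfl, if_pos rfl]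
      · rw [if_neg (fun h => hab (he h)), if_neg hab]
    · intro x _ hx
      rw [Matrix.transpose_apply, res_apply e b x, if_neg (Ne.symm hx), mul_zero]
    · intro h; exact absurd (Finset.mem_univ _) h

/-- a multiplication operator passes through the extension: `diagonal h · resᵀ = resᵀ · diagonal (h ∘ e)`.
[cite: Balaban1983RegularityDecay, (2.6) p.576, dictionary] -/
theorem diagonal_mul_transpose_res (e : X' → X) (h : X → ℝ) :
    Matrix.diagonal h * (res e)ᵀ = (res e)ᵀ * Matrix.diagonal (h ∘ e) := by
  ext x a
  rw [Matrix.diagonal_mul, Matrix.mul_diagonal, Matrix.transpose_apply, res_apply, Function.comp_apply]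
  by_cases hx : e a = x
  · rw [if_pos hx, hx, mul_one, one_mul]
  · rw [if_neg hx, mul_zero, zero_mul]

/-- … and through the restriction: `res · diagonal h = diagonal (h ∘ e) · res`. [cite: Balaban1983RegularityDecay, (2.6) p.576, dictionary] -/
theorem res_mul_diagonal (e : X' → X) (h : X → ℝ) :
    res e * Matrix.diagonal h = Matrix.diagonal (h ∘ e) * res e := by
  ext a x
  rw [Matrix.mul_diagonal, Matrix.diagonal_mul, res_apply, Function.comp_apply]
  by_cases hx : e a = x
  · rw [if_pos hx, hx, mul_one, one_mul]
  · rw [if_neg hx, mul_zero, zero_mul]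

omit [DecidableEq X'] in
/-- a multiplication operator supported in the image is unchanged by `resᵀ·res` (the indicator of the image).
[cite: Balaban1983RegularityDecay, (2.6) p.576, dictionary] -/
theorem diagonal_mul_transpose_res_mul_res {e : X' → X} (he : Function.Injective e) (h : X → ℝ)
    (hh : ∀ x, h x ≠ 0 → ∃ a, e a = x) : Matrix.diagonal h * ((res e)ᵀ * res e) = Matrix.diagonal h := by
  ext x y
  rw [Matrix.diagonal_mul, Matrix.diagonal_apply]
  by_cases hx : h x = 0
  · rw [hx, zero_mul]; split_ifs <;> rfl
  · obtain ⟨a, rfl⟩ := hh x hx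
    rw [transpose_res_mul_apply_img he, res_apply]
    by_cases hy : e a = y
    · rw [if_pos hy, if_pos hy, mul_one]
    · rw [if_neg hy, if_neg hy, mul_zero]

/-- **THE ALGEBRA OF ONE TERM OF `R`**: if `h·E = h·(resᵀE_□res)` (localisation) for symmetric `E`, `E_□`, then
`(hE − Eh)·(resᵀGres)·h = resᵀ·((h′E_□ − E_□h′)·G·h′)·res` with `h′ = h ∘ e`: the global commutator term of (2.38) IS the
padded local one. [cite: Balaban1984PropagatorsII, (2.38) p.229; Balaban1983RegularityDecay, (2.6) p.576] -/
theorem kOp_pad_eq {e : X' → X} (he : Function.Injective e) (E : Matrix X X ℝ) (El G : Matrix X' X' ℝ) (h : X → ℝ)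
    (hloc : Matrix.diagonal h * E = Matrix.diagonal h * ((res e)ᵀ * El * res e)) (hE : Eᵀ = E) (hEl : Elᵀ = El) :
    (Matrix.diagonal h * E - E * Matrix.diagonal h) * ((res e)ᵀ * G * res e) * Matrix.diagonal h
      = (res e)ᵀ * ((Matrix.diagonal (h ∘ e) * El - El * Matrix.diagonal (h ∘ e)) * G * Matrix.diagonal (h ∘ e))
          * res e := by
  have hloc2 : E * Matrix.diagonal h = (res e)ᵀ * El * res e * Matrix.diagonal h := by
    have := congrArg Matrix.transpose hloc
    rw [Matrix.transpose_mul, Matrix.transpose_mul, Matrix.diagonal_transpose, hE, Matrix.transpose_mul,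
      Matrix.transpose_mul, Matrix.transpose_transpose, hEl, ← Matrix.mul_assoc] at this
    exact this
  have hdr : Matrix.diagonal h * (res e)ᵀ = (res e)ᵀ * Matrix.diagonal (h ∘ e) := diagonal_mul_transpose_res e h
  have hrd : res e * Matrix.diagonal h = Matrix.diagonal (h ∘ e) * res e := res_mul_diagonal e h
  have hrr : res e * (res e)ᵀ = 1 := res_mul_transpose_res he
  have h1 : Matrix.diagonal h * E * ((res e)ᵀ * G * res e) * Matrix.diagonal h
      = (res e)ᵀ * (Matrix.diagonal (h ∘ e) * El * G * Matrix.diagonal (h ∘ e)) * res e := by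
    rw [hloc]
    calc Matrix.diagonal h * ((res e)ᵀ * El * res e) * ((res e)ᵀ * G * res e) * Matrix.diagonal h
        = Matrix.diagonal h * (res e)ᵀ * El * (res e * (res e)ᵀ) * G * (res e * Matrix.diagonal h) := by
          simp only [Matrix.mul_assoc]
      _ = (res e)ᵀ * (Matrix.diagonal (h ∘ e) * El * G * Matrix.diagonal (h ∘ e)) * res e := by
          rw [hrr, Matrix.mul_one, hdr, hrd]; simp only [Matrix.mul_assoc]
  have h2 : E * Matrix.diagonal h * ((res e)ᵀ * G * res e) * Matrix.diagonal h
      = (res e)ᵀ * (El * Matrix.diagonal (h ∘ e) * G * Matrix.diagonal (h ∘ e)) * res e := by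
    calc E * Matrix.diagonal h * ((res e)ᵀ * G * res e) * Matrix.diagonal h
        = (res e)ᵀ * El * (res e * (Matrix.diagonal h * (res e)ᵀ)) * G * (res e * Matrix.diagonal h) := by
          rw [hloc2]; simp only [Matrix.mul_assoc]
      _ = (res e)ᵀ * (El * Matrix.diagonal (h ∘ e) * G * Matrix.diagonal (h ∘ e)) * res e := by
          rw [hdr, ← Matrix.mul_assoc (res e) (res e)ᵀ, hrr, Matrix.one_mul, hrd]; simp only [Matrix.mul_assoc]
  rw [Matrix.sub_mul, Matrix.sub_mul, h1, h2]
  simp only [Matrix.sub_mul, Matrix.mul_sub, Matrix.mul_assoc]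

end Res

/-! ## §2 The cut cubes of the box `Ω` as sub-boxes of the two-level lineage -/

section Cubes

variable (ℓ k Mh : ℕ) (P : Fin (d + 1) → ℕ) (q : Fin (d + 1) → ℤ)

/-- the sides of the cut cube `□_q`, in `L`-blocks: `M_h·cubeW`. [cite: Balaban1983RegularityDecay, §2 p.575 («□_j = Ω ∩ {…}»)] -/
def cubeM' : Fin (d + 1) → ℕ := fun i => Mh * cubeW P q i

/-- the lower corner of the cut cube `□_q`, in unit blocks: `L·M_h·cubeLo`. [cite: Balaban1983RegularityDecay, §2 p.575] -/
def cubeO : Fin (d + 1) → ℕ := fun i => (ℓ + 1) * (Mh * cubeLo q i)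

variable {ℓ k Mh P q}

/-- the cut cube sits inside `Ω`. [cite: Balaban1983RegularityDecay, §2 p.575] -/
theorem cube_ho (hP : ∀ i, 1 ≤ P i) (hq : q ∈ ctrs P) :
    ∀ i, cubeO ℓ Mh q i + (ℓ + 1) * cubeM' Mh P q i ≤ (ℓ + 1) * (Mh * P i) := by
  intro i
  unfold cubeO cubeM'
  rw [← Nat.mul_assoc (ℓ + 1) Mh, Nat.mul_assoc, ← Nat.mul_add, ← Nat.mul_add]
  exact Nat.mul_le_mul_left _ (Nat.mul_le_mul_left _ (cubeLo_add_cubeW_le hP hq i))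

variable (ℓ k Mh P q)

/-- **THE EMBEDDING OF THE CUT CUBE `□_q` INTO `Ω`** (fine sites; `B4SubBoxCarrier.subEmb`, shift `n·cubeO`).
[cite: Balaban1983RegularityDecay, §2 p.575 («□_j = Ω ∩ {a sum of large blocks …}»)] -/
def emb (hP : ∀ i, 1 ≤ P i) (hq : q ∈ ctrs P) :
    ↥(Box d ℓ k (fun i => (ℓ + 1) * cubeM' Mh P q i)) → ↥(Box d ℓ k (fun i => (ℓ + 1) * (Mh * P i))) :=
  subEmb ℓ k (fun i => (ℓ + 1) * (Mh * P i)) (fun i => (ℓ + 1) * cubeM' Mh P q i) (cubeO ℓ Mh q) (cube_ho hP hq)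

/-- the embedding of the unit blocks of `□_q` (`B4SubBoxCarrier.subEmbY`, shift `cubeO`). [cite: Balaban1983RegularityDecay, §2 p.575] -/
def embY (hP : ∀ i, 1 ≤ P i) (hq : q ∈ ctrs P) :
    ↥(boxDom (fun i => (ℓ + 1) * cubeM' Mh P q i)) → ↥(boxDom (fun i => (ℓ + 1) * (Mh * P i))) :=
  subEmbY (fun i => (ℓ + 1) * (Mh * P i)) (fun i => (ℓ + 1) * cubeM' Mh P q i) (cubeO ℓ Mh q) (cube_ho hP hq)

/-- `Λ_q := Λ ∩ □_q^{(j)}` pulled back to the cube («Λ = □^{(j)} ∩ B(Λ_{j+1})»). [cite: Balaban1984PropagatorsII, p.230 («where Λ = □^{(j)} ∩ B(Λ_{j+1})»)] -/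
def lamLoc (hP : ∀ i, 1 ≤ P i) (hq : q ∈ ctrs P) (Λ : Finset ↥(boxDom (fun i => (ℓ + 1) * (Mh * P i)))) :
    Finset ↥(boxDom (fun i => (ℓ + 1) * cubeM' Mh P q i)) :=
  Finset.univ.filter fun y => embY ℓ Mh P q hP hq y ∈ Λ

variable {ℓ k Mh P q}

/-- the fine coordinates of an embedded site: `emb a = a + N·cubeLo`, `N = n·L·M_h`. [cite: Balaban1983RegularityDecay, §2 p.575] -/
theorem emb_val (hP : ∀ i, 1 ≤ P i) (hq : q ∈ ctrs P) (a : ↥(Box d ℓ k (fun i => (ℓ + 1) * cubeM' Mh P q i))) :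
    (emb ℓ k Mh P q hP hq a).1 = a.1 + fun i => (((ℓ + 1) ^ k * ((ℓ + 1) * Mh) : ℕ) : ℤ) * (cubeLo q i : ℤ) := by
  funext i
  simp only [emb, subEmb, cubeO, Pi.add_apply]
  push_cast
  ring

/-- the same, written as a translate by a multiple of the unit block `n`. [cite: Balaban1983RegularityDecay, §2 p.575] -/
theorem emb_val' (hP : ∀ i, 1 ≤ P i) (hq : q ∈ ctrs P) (a : ↥(Box d ℓ k (fun i => (ℓ + 1) * cubeM' Mh P q i))) :
    (emb ℓ k Mh P q hP hq a).1 = a.1 + fun i => (((ℓ + 1) ^ k : ℕ) : ℤ) * (cubeO ℓ Mh q i : ℤ) := by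
  funext i
  simp only [emb, subEmb, Pi.add_apply]

/-- … and as a translate by a multiple of the `L`-block `nL`. [cite: Balaban1983RegularityDecay, §2 p.575] -/
theorem emb_val'' (hP : ∀ i, 1 ≤ P i) (hq : q ∈ ctrs P) (a : ↥(Box d ℓ k (fun i => (ℓ + 1) * cubeM' Mh P q i))) :
    (emb ℓ k Mh P q hP hq a).1 = a.1 + fun i => (((ℓ + 1) ^ k * (ℓ + 1) : ℕ) : ℤ) * ((Mh * cubeLo q i : ℕ) : ℤ) := by
  funext i
  simp only [emb, subEmb, cubeO, Pi.add_apply]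
  push_cast
  ring

/-- the unit coordinates of an embedded block: `embY y = y + cubeO`. [cite: Balaban1983RegularityDecay, §2 p.575] -/
theorem embY_val (hP : ∀ i, 1 ≤ P i) (hq : q ∈ ctrs P) (y : ↥(boxDom (fun i => (ℓ + 1) * cubeM' Mh P q i))) :
    (embY ℓ Mh P q hP hq y).1 = y.1 + fun i => (((ℓ + 1) : ℕ) : ℤ) * ((Mh * cubeLo q i : ℕ) : ℤ) := by
  funext i
  simp only [embY, subEmbY, cubeO, Pi.add_apply]
  push_cast
  ring

/-- `emb` is injective. [cite: Balaban1983RegularityDecay, §2 p.575, dictionary] -/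
theorem emb_injective (hP : ∀ i, 1 ≤ P i) (hq : q ∈ ctrs P) : Function.Injective (emb ℓ k Mh P q hP hq) :=
  subEmb_injective _ _ _ _ _ _

/-- the unit block of an embedded site is the embedded unit block. [cite: Balaban1983RegularityDecay, (1.1) p.572] -/
theorem ublk_emb {n : ℕ} (hn : 1 ≤ n) (hnk : n = (ℓ + 1) ^ k) (hP : ∀ i, 1 ≤ P i) (hq : q ∈ ctrs P)
    (a : ↥(Box d ℓ k (fun i => (ℓ + 1) * cubeM' Mh P q i))) :
    ublk hn (M := fun i => (ℓ + 1) * (Mh * P i)) (hnk ▸ emb ℓ k Mh P q hP hq a)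
      = embY ℓ Mh P q hP hq (ublk hn (M := fun i => (ℓ + 1) * cubeM' Mh P q i) (hnk ▸ a)) := by
  subst hnk
  apply Subtype.ext
  show blk ((ℓ + 1) ^ k) (emb ℓ k Mh P q hP hq a).1 = (embY ℓ Mh P q hP hq (ublk hn a)).1
  rw [emb, blk_subEmb]
  rfl

/-- `Λ_q` is a union of `L`-blocks when `Λ` is (the corner `cubeO` is a multiple of `L`).
[cite: Balaban1984PropagatorsII, p.230 («Λ being a sum of big blocks»-type bookkeeping)] -/
theorem isBlockUnion_lamLoc (hP : ∀ i, 1 ≤ P i) (hq : q ∈ ctrs P)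
    {Λ : Finset ↥(boxDom (fun i => (ℓ + 1) * (Mh * P i)))} (hΛ : IsBlockUnion ℓ (fun i => Mh * P i) Λ) :
    IsBlockUnion ℓ (cubeM' Mh P q) (lamLoc ℓ Mh P q hP hq Λ) := by
  have hL : 1 ≤ ℓ + 1 := by omega
  intro y hy y' hyy'
  simp only [lamLoc, Finset.mem_filter, Finset.mem_univ, true_and] at hy ⊢
  refine hΛ _ hy _ ?_
  rw [embY_val, embY_val, blk_add_mul hL, blk_add_mul hL, hyy']

/-- **MEMBERSHIP IN THE CUBE THROUGH `L`-BLOCKS**: a site of `Ω` lies in `□_q` iff its `L`-block index lies in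
`Π[M_h·cubeLo, M_h·(cubeLo + cubeW))` (the cube is a union of `L`-blocks). [cite: Balaban1983RegularityDecay, §2 p.575] -/
theorem inSub_iff_blkL (x : ↥(Box d ℓ k (fun i => (ℓ + 1) * (Mh * P i)))) :
    inSub ℓ k (fun i => (ℓ + 1) * (Mh * P i)) (fun i => (ℓ + 1) * cubeM' Mh P q i) (cubeO ℓ Mh q) x
      ↔ ∀ i, ((Mh * cubeLo q i : ℕ) : ℤ) ≤ blk ((ℓ + 1) ^ k * (ℓ + 1)) x.1 i
          ∧ blk ((ℓ + 1) ^ k * (ℓ + 1)) x.1 i < ((Mh * (cubeLo q i + cubeW P q i) : ℕ) : ℤ) := by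
  have hb : (0 : ℤ) < (((ℓ + 1) ^ k * (ℓ + 1) : ℕ) : ℤ) := by positivity
  unfold inSub blk
  refine forall_congr' fun i => ?_
  rw [Int.le_ediv_iff_mul_le hb, Int.ediv_lt_iff_lt_mul hb]
  simp only [cubeO, cubeM']
  push_cast
  constructor
  · rintro ⟨h1, h2⟩; constructor <;> nlinarith
  · rintro ⟨h1, h2⟩; constructor <;> nlinarith

/-- a site of `Ω` in the same `L`-block as a site of `□_q` lies in `□_q`. [cite: Balaban1983RegularityDecay, §2 p.575] -/
theorem exists_emb_eq_of_blkL (hP : ∀ i, 1 ≤ P i) (hq : q ∈ ctrs P)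
    (a : ↥(Box d ℓ k (fun i => (ℓ + 1) * cubeM' Mh P q i))) {x : ↥(Box d ℓ k (fun i => (ℓ + 1) * (Mh * P i)))}
    (hx : blk ((ℓ + 1) ^ k * (ℓ + 1)) x.1 = blk ((ℓ + 1) ^ k * (ℓ + 1)) (emb ℓ k Mh P q hP hq a).1) :
    ∃ b, emb ℓ k Mh P q hP hq b = x := by
  rw [emb, ← inSub_iff]
  rw [inSub_iff_blkL, hx, ← inSub_iff_blkL]
  exact (inSub_iff _ _ _ _ _ (cube_ho hP hq) _).2 ⟨a, rfl⟩

/-- a site of `Ω` in the same unit block as a site of `□_q` lies in `□_q`. [cite: Balaban1983RegularityDecay, §2 p.575] -/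
theorem exists_emb_eq_of_blk (hP : ∀ i, 1 ≤ P i) (hq : q ∈ ctrs P)
    (a : ↥(Box d ℓ k (fun i => (ℓ + 1) * cubeM' Mh P q i))) {x : ↥(Box d ℓ k (fun i => (ℓ + 1) * (Mh * P i)))}
    (hx : blk ((ℓ + 1) ^ k) x.1 = blk ((ℓ + 1) ^ k) (emb ℓ k Mh P q hP hq a).1) :
    ∃ b, emb ℓ k Mh P q hP hq b = x := by
  rw [emb, ← inSub_iff]
  exact inSub_of_blk_eq _ _ _ _ _ hx.symm ((inSub_iff _ _ _ _ _ (cube_ho hP hq) _).2 ⟨a, rfl⟩)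

end Cubes

/-! ## §3 Localisation: the rows of `E` off the internal layer of `□_q` are the rows of `E_q` ([3] (2.6)) -/

section Localisation

variable {ℓ k Mh : ℕ} {P : Fin (d + 1) → ℕ} {q : Fin (d + 1) → ℤ}

/-- **THE INTERNAL BOUNDARY LAYER** of the cut cube `□_q`: the sites adjacent (across a face) to a site of `Ω ∖ □_q` —
the sites on a lower face that is not the face `q_μ = 0` of `Ω`, or on an upper face that is not the face `q_μ = P_μ`.
[cite: Balaban1983RegularityDecay, (2.6) p.576 («the part of the boundary of □_j which is contained in the boundary of Ω»)] -/
def IL (ℓ k Mh : ℕ) (P : Fin (d + 1) → ℕ) (q : Fin (d + 1) → ℤ)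
    (a : ↥(Box d ℓ k (fun i => (ℓ + 1) * cubeM' Mh P q i))) : Prop :=
  ∃ i, (a.1 i = 0 ∧ 0 < cubeLo q i)
    ∨ (a.1 i + 1 = (((ℓ + 1) ^ k * ((ℓ + 1) * cubeM' Mh P q i) : ℕ) : ℤ) ∧ cubeLo q i + cubeW P q i < P i)

/-- **OFF THE INTERNAL LAYER, EVERY `Ω`-NEIGHBOUR LIES IN THE CUBE.** [cite: Balaban1983RegularityDecay, (2.6) p.576] -/
theorem exists_emb_eq_of_nbr (hP : ∀ i, 1 ≤ P i) (hq : q ∈ ctrs P)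
    {a : ↥(Box d ℓ k (fun i => (ℓ + 1) * cubeM' Mh P q i))} (ha : ¬ IL ℓ k Mh P q a)
    {x : ↥(Box d ℓ k (fun i => (ℓ + 1) * (Mh * P i)))} (hx : x.1 ∈ nbrs (emb ℓ k Mh P q hP hq a).1) :
    ∃ b, emb ℓ k Mh P q hP hq b = x := by
  rw [emb, ← inSub_iff]
  have himg : inSub ℓ k (fun i => (ℓ + 1) * (Mh * P i)) (fun i => (ℓ + 1) * cubeM' Mh P q i) (cubeO ℓ Mh q)
      (emb ℓ k Mh P q hP hq a) := (inSub_iff _ _ _ _ _ (cube_ho hP hq) _).2 ⟨a, rfl⟩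
  have hav := mem_boxDom.1 a.2
  have hxv := mem_boxDom.1 x.2
  have hev : ∀ j, (emb ℓ k Mh P q hP hq a).1 j = a.1 j + (((ℓ + 1) ^ k : ℕ) : ℤ) * (cubeO ℓ Mh q j : ℤ) :=
    fun j => by rw [emb_val']; rfl
  unfold IL at ha
  push Not at ha
  obtain ⟨i, hi | hi⟩ := mem_nbrs.1 hx
  · intro j
    have hj := himg j
    rw [hev j] at hj
    rw [hi]
    by_cases hji : j = i
    · -- forward neighbour, the moving coordinate
      subst hji
      simp only [Pi.add_apply, Pi.single_eq_same, hev j]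
      refine ⟨by linarith [hj.1], ?_⟩
      obtain ⟨ha1, ha2⟩ := ha j
      have h2 := (hav j).2
      have hle := cubeLo_add_cubeW_le hP hq j
      by_cases heq : a.1 j + 1 = (((ℓ + 1) ^ k * ((ℓ + 1) * cubeM' Mh P q j) : ℕ) : ℤ)
      · -- top layer: the cube reaches the upper face of Ω there, and the neighbour would leave Ω
        exfalso
        have hfull : cubeLo q j + cubeW P q j = P j := le_antisymm hle (ha2 heq)
        have hxj := (hxv j).2
        rw [hi] at hxj
        simp only [Pi.add_apply, Pi.single_eq_same, hev j] at hxj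
        have e1 : ((ℓ + 1) * (Mh * P j) : ℕ) = cubeO ℓ Mh q j + (ℓ + 1) * cubeM' Mh P q j := by
          unfold cubeO cubeM'; rw [← hfull]; ring
        have e2 : ((((ℓ + 1) ^ k * ((ℓ + 1) * (Mh * P j)) : ℕ) : ℤ))
            = (((ℓ + 1) ^ k : ℕ) : ℤ) * ((cubeO ℓ Mh q j : ℤ) + (((ℓ + 1) * cubeM' Mh P q j : ℕ) : ℤ)) := by
          rw [e1]; push_cast; ring
        have hxj' : a.1 j + (((ℓ + 1) ^ k : ℕ) : ℤ) * (cubeO ℓ Mh q j : ℤ) + 1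
            < (((ℓ + 1) ^ k : ℕ) : ℤ) * ((cubeO ℓ Mh q j : ℤ) + (((ℓ + 1) * cubeM' Mh P q j : ℕ) : ℤ)) := by
          rw [← e2]; exact hxj
        have heq' : a.1 j + 1 = (((ℓ + 1) ^ k : ℕ) : ℤ) * (((ℓ + 1) * cubeM' Mh P q j : ℕ) : ℤ) := by
          rw [heq]; push_cast; ring
        nlinarith
      · have hlt : a.1 j + 1 < (((ℓ + 1) ^ k * ((ℓ + 1) * cubeM' Mh P q j) : ℕ) : ℤ) :=
          lt_of_le_of_ne (Int.add_one_le_iff.2 h2) heq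
        obtain ⟨hj1, -⟩ := hj
        push_cast at hlt hj1 ⊢
        nlinarith
    · simp only [Pi.add_apply, Pi.single_eq_of_ne hji, add_zero]
      exact hj
  · intro j
    have hj := himg j
    rw [hev j] at hj
    rw [hi]
    by_cases hji : j = i
    · -- backward neighbour, the moving coordinate
      subst hji
      simp only [Pi.sub_apply, Pi.single_eq_same, hev j]
      refine ⟨?_, by linarith [hj.2]⟩
      obtain ⟨ha1, ha2⟩ := ha j
      have h1 := (hav j).1
      by_cases heq : a.1 j = 0
      · -- bottom layer: the cube starts at the lower face of Ω there, and the neighbour would leave Ω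
        have hzero : cubeLo q j = 0 := Nat.le_zero.1 (ha1 heq)
        have hO : (cubeO ℓ Mh q j : ℤ) = 0 := by simp [cubeO, hzero]
        have hxj := (hxv j).1
        rw [hi] at hxj
        simp only [Pi.sub_apply, Pi.single_eq_same, hev j, hO] at hxj
        rw [hO]
        linarith
      · have : 1 ≤ a.1 j := by omega
        linarith
    · simp only [Pi.sub_apply, Pi.single_eq_of_ne hji, sub_zero]
      exact hj

/-- off the internal layer the `Ω`-degree of a site is its `□_q`-degree (the Neumann Laplacians of `Ω` and of `□_q`
agree there). [cite: Balaban1983RegularityDecay, (2.6) p.576] -/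
theorem degree_eq_of_not_IL (hP : ∀ i, 1 ≤ P i) (hq : q ∈ ctrs P)
    {a : ↥(Box d ℓ k (fun i => (ℓ + 1) * cubeM' Mh P q i))} (ha : ¬ IL ℓ k Mh P q a) :
    ((nbrs (emb ℓ k Mh P q hP hq a).1).filter
        (fun z => z ∈ Box d ℓ k (fun i => (ℓ + 1) * (Mh * P i)))).card
      = ((nbrs a.1).filter (fun z => z ∈ Box d ℓ k (fun i => (ℓ + 1) * cubeM' Mh P q i))).card := by
  set t : Fin (d + 1) → ℤ := fun i => (((ℓ + 1) ^ k : ℕ) : ℤ) * (cubeO ℓ Mh q i : ℤ) with ht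
  have hev : (emb ℓ k Mh P q hP hq a).1 = a.1 + t := emb_val' hP hq a
  symm
  refine Finset.card_bij (fun z _ => z + t) ?_ ?_ ?_
  · intro z hz
    rw [Finset.mem_filter] at hz ⊢
    refine ⟨by rw [hev]; exact (mem_nbrs_add_iff _ _ _).2 hz.1, ?_⟩
    exact (shift_mem_Box ℓ k _ _ _ (cube_ho hP hq) ⟨z, hz.2⟩)
  · intro z _ z' _ h
    exact add_right_cancel h
  · intro w hw
    rw [Finset.mem_filter] at hw
    obtain ⟨b, hb⟩ := exists_emb_eq_of_nbr hP hq ha (x := ⟨w, hw.2⟩) hw.1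
    have hbw : b.1 + t = w := by
      have := congrArg Subtype.val hb
      rw [emb_val' hP hq b] at this
      exact this
    refine ⟨b.1, ?_, hbw⟩
    rw [Finset.mem_filter]
    refine ⟨?_, b.2⟩
    have h1 := hw.1
    rw [hev, ← hbw] at h1
    exact (mem_nbrs_add_iff _ _ _).1 h1

variable {n : ℕ} (hn : 1 ≤ n) (hnk : (ℓ + 1) ^ k = n)

/-- **THE ENTRIES OF `E` AT AN EMBEDDED PAIR ARE THE ENTRIES OF `E_q`** (off the internal layer): Laplacian part by
translation invariance of the bonds and `degree_eq_of_not_IL`, mass part trivially, averaging part because the unit and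
`L`-blocks of `□_q` are blocks of `Ω` and `Λ_q = Λ ∩ □_q`. [cite: Balaban1984PropagatorsII, (2.37) p.229 with [3] (2.6) p.576] -/
theorem twoLevelOp_emb_emb (hℓ : 1 ≤ ℓ) (hP : ∀ i, 1 ≤ P i) (hq : q ∈ ctrs P) (aj a m2 : ℝ)
    {Λ : Finset ↥(boxDom (fun i => (ℓ + 1) * (Mh * P i)))} (hΛ : IsBlockUnion ℓ (fun i => Mh * P i) Λ)
    {x : ↥(Box d ℓ k (fun i => (ℓ + 1) * cubeM' Mh P q i))} (hx : ¬ IL ℓ k Mh P q x)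
    (b : ↥(Box d ℓ k (fun i => (ℓ + 1) * cubeM' Mh P q i))) :
    twoLevelOp ((ℓ + 1) ^ k) ℓ aj a m2 (fun i => Mh * P i) Λ (emb ℓ k Mh P q hP hq x) (emb ℓ k Mh P q hP hq b)
      = twoLevelOp ((ℓ + 1) ^ k) ℓ aj a m2 (cubeM' Mh P q) (lamLoc ℓ Mh P q hP hq Λ) x b := by
  have hn1 : 1 ≤ (ℓ + 1) ^ k := Nat.one_le_pow _ _ (by omega)
  have hL : 1 ≤ (ℓ + 1) ^ k * (ℓ + 1) := Nat.one_le_iff_ne_zero.2 (by positivity)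
  have hinj := emb_injective (ℓ := ℓ) (k := k) (Mh := Mh) hP hq
  rw [twoLevelOp_apply hn1 aj a m2 hΛ, twoLevelOp_apply hn1 aj a m2 (isBlockUnion_lamLoc hP hq hΛ)]
  -- (i) the Laplacian entries
  have hval : ∀ c : ↥(Box d ℓ k (fun i => (ℓ + 1) * cubeM' Mh P q i)),
      (emb ℓ k Mh P q hP hq c).1 = c.1 + fun i => (((ℓ + 1) ^ k : ℕ) : ℤ) * (cubeO ℓ Mh q i : ℤ) := emb_val' hP hq
  have hlap : (neumannLapK (fun i => (ℓ + 1) ^ k * ((ℓ + 1) * (Mh * P i))) (emb ℓ k Mh P q hP hq x).1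
        (emb ℓ k Mh P q hP hq b).1 : ℝ)
      = neumannLapK (fun i => (ℓ + 1) ^ k * ((ℓ + 1) * cubeM' Mh P q i)) x.1 b.1 := by
    unfold neumannLapK
    have e1 : ((emb ℓ k Mh P q hP hq b).1 = (emb ℓ k Mh P q hP hq x).1) ↔ (b.1 = x.1) := by
      constructor
      · intro h; exact congrArg Subtype.val (hinj (Subtype.ext h))
      · intro h; rw [show b = x from Subtype.ext h]
    have e2 : ((emb ℓ k Mh P q hP hq b).1 ∈ nbrs (emb ℓ k Mh P q hP hq x).1) ↔ (b.1 ∈ nbrs x.1) := by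
      rw [hval, hval, mem_nbrs_add_iff]
    simp only [e1, e2, degree_eq_of_not_IL hP hq hx]
  -- (ii) the mass entries
  have hdiag : (diagK m2 (emb ℓ k Mh P q hP hq x).1 (emb ℓ k Mh P q hP hq b).1 : ℝ) = diagK m2 x.1 b.1 := by
    unfold diagK
    have e1 : ((emb ℓ k Mh P q hP hq b).1 = (emb ℓ k Mh P q hP hq x).1) ↔ (b.1 = x.1) := by
      constructor
      · intro h; exact congrArg Subtype.val (hinj (Subtype.ext h))
      · intro h; rw [show b = x from Subtype.ext h]
    simp only [e1]
  -- (iii) the averaging entries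
  have hub : ∀ c : ↥(Box d ℓ k (fun i => (ℓ + 1) * cubeM' Mh P q i)),
      (ublk hn1 (M := fun i => (ℓ + 1) * (Mh * P i)) (emb ℓ k Mh P q hP hq c) ∈ Λ)
        ↔ (ublk hn1 (M := fun i => (ℓ + 1) * cubeM' Mh P q i) c ∈ lamLoc ℓ Mh P q hP hq Λ) := by
    intro c
    rw [ublk_emb hn1 rfl hP hq c]
    simp [lamLoc]
  have hbL : (blk ((ℓ + 1) ^ k * (ℓ + 1)) (emb ℓ k Mh P q hP hq b).1 = blk ((ℓ + 1) ^ k * (ℓ + 1)) (emb ℓ k Mh P q hP hq x).1)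
      ↔ (blk ((ℓ + 1) ^ k * (ℓ + 1)) b.1 = blk ((ℓ + 1) ^ k * (ℓ + 1)) x.1) := by
    rw [emb_val'' hP hq, emb_val'' hP hq, blk_add_mul hL, blk_add_mul hL]
    constructor
    · intro h; exact add_right_cancel h
    · intro h; rw [h]
  have hb1 : (blk ((ℓ + 1) ^ k) (emb ℓ k Mh P q hP hq b).1 = blk ((ℓ + 1) ^ k) (emb ℓ k Mh P q hP hq x).1)
      ↔ (blk ((ℓ + 1) ^ k) b.1 = blk ((ℓ + 1) ^ k) x.1) := by
    rw [hval, hval, blk_add_mul hn1, blk_add_mul hn1]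
    constructor
    · intro h; exact add_right_cancel h
    · intro h; rw [h]
  rw [hlap, hdiag]
  congr 1
  simp only [hub, hbL, avgK, hb1]

/-- **THE ENTRIES OF `E` FROM AN EMBEDDED SITE TO A SITE OUTSIDE THE CUBE VANISH** (off the internal layer): it is not a
neighbour (`exists_emb_eq_of_nbr`) and shares no unit or `L`-block with the row site. [cite: Balaban1983RegularityDecay, (2.6) p.576] -/
theorem twoLevelOp_emb_off (hℓ : 1 ≤ ℓ) (hP : ∀ i, 1 ≤ P i) (hq : q ∈ ctrs P) (aj a m2 : ℝ)
    {Λ : Finset ↥(boxDom (fun i => (ℓ + 1) * (Mh * P i)))} (hΛ : IsBlockUnion ℓ (fun i => Mh * P i) Λ)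
    {x : ↥(Box d ℓ k (fun i => (ℓ + 1) * cubeM' Mh P q i))} (hx : ¬ IL ℓ k Mh P q x)
    {z : ↥(Box d ℓ k (fun i => (ℓ + 1) * (Mh * P i)))} (hz : ∀ b, emb ℓ k Mh P q hP hq b ≠ z) :
    twoLevelOp ((ℓ + 1) ^ k) ℓ aj a m2 (fun i => Mh * P i) Λ (emb ℓ k Mh P q hP hq x) z = 0 := by
  have hn1 : 1 ≤ (ℓ + 1) ^ k := Nat.one_le_pow _ _ (by omega)
  rw [twoLevelOp_apply hn1 aj a m2 hΛ]
  have hne : z.1 ≠ (emb ℓ k Mh P q hP hq x).1 := fun h => hz x (Subtype.ext h.symm)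
  have hnb : z.1 ∉ nbrs (emb ℓ k Mh P q hP hq x).1 := fun h => by
    obtain ⟨b, hb⟩ := exists_emb_eq_of_nbr hP hq hx h
    exact hz b hb
  have hlap : (neumannLapK (fun i => (ℓ + 1) ^ k * ((ℓ + 1) * (Mh * P i))) (emb ℓ k Mh P q hP hq x).1 z.1 : ℝ) = 0 := by
    unfold neumannLapK; rw [if_neg hne, if_neg hnb]
  have hdiag : (diagK m2 (emb ℓ k Mh P q hP hq x).1 z.1 : ℝ) = 0 := by
    unfold diagK; rw [if_neg hne]
  have hbL : blk ((ℓ + 1) ^ k * (ℓ + 1)) z.1 ≠ blk ((ℓ + 1) ^ k * (ℓ + 1)) (emb ℓ k Mh P q hP hq x).1 := fun h => by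
    obtain ⟨b, hb⟩ := exists_emb_eq_of_blkL hP hq x h
    exact hz b hb
  have hb1 : blk ((ℓ + 1) ^ k) z.1 ≠ blk ((ℓ + 1) ^ k) (emb ℓ k Mh P q hP hq x).1 := fun h => by
    obtain ⟨b, hb⟩ := exists_emb_eq_of_blk hP hq x h
    exact hz b hb
  rw [hlap, hdiag, mul_zero, zero_add, zero_add]
  by_cases hu : ublk hn1 (M := fun i => (ℓ + 1) * (Mh * P i)) (emb ℓ k Mh P q hP hq x) ∈ Λ
  · rw [if_pos hu, if_neg hbL]
  · rw [if_neg hu]; unfold avgK; rw [if_neg hb1]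

/-- **LOCALISATION, ROW FORM**: off the internal layer, the row of `E` at `emb x` is the row of the padded cube operator
`resᵀ·E_q·res`. [cite: Balaban1984PropagatorsII, (2.37)–(2.38) p.229 with [3] (2.6) p.576] -/
theorem row_eq_pad_row (hℓ : 1 ≤ ℓ) (hP : ∀ i, 1 ≤ P i) (hq : q ∈ ctrs P) (aj a m2 : ℝ)
    {Λ : Finset ↥(boxDom (fun i => (ℓ + 1) * (Mh * P i)))} (hΛ : IsBlockUnion ℓ (fun i => Mh * P i) Λ)
    {x : ↥(Box d ℓ k (fun i => (ℓ + 1) * cubeM' Mh P q i))} (hx : ¬ IL ℓ k Mh P q x)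
    (z : ↥(Box d ℓ k (fun i => (ℓ + 1) * (Mh * P i)))) :
    twoLevelOp ((ℓ + 1) ^ k) ℓ aj a m2 (fun i => Mh * P i) Λ (emb ℓ k Mh P q hP hq x) z
      = ((res (emb ℓ k Mh P q hP hq))ᵀ * twoLevelOp ((ℓ + 1) ^ k) ℓ aj a m2 (cubeM' Mh P q) (lamLoc ℓ Mh P q hP hq Λ)
          * res (emb ℓ k Mh P q hP hq)) (emb ℓ k Mh P q hP hq x) z := by
  have hinj := emb_injective (ℓ := ℓ) (k := k) (Mh := Mh) hP hq
  rw [Matrix.mul_assoc, transpose_res_mul_apply_img hinj]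
  by_cases hz : ∃ b, emb ℓ k Mh P q hP hq b = z
  · obtain ⟨b, rfl⟩ := hz
    rw [mul_res_apply_img hinj, twoLevelOp_emb_emb hℓ hP hq aj a m2 hΛ hx b]
  · push Not at hz
    rw [mul_res_apply_off _ _ _ hz, twoLevelOp_emb_off hℓ hP hq aj a m2 hΛ hx hz]

/-- **LOCALISATION, OPERATOR FORM ([3] (2.6) for the two-level operator)**: for every multiplication operator `h` on `Ω`
supported in `□_q` off its internal layer, `h·E = h·(resᵀE_q res)`. [cite: Balaban1984PropagatorsII, (2.38) p.229; Balaban1983RegularityDecay, (2.6) p.576] -/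
theorem diagonal_mul_eq_pad (hℓ : 1 ≤ ℓ) (hP : ∀ i, 1 ≤ P i) (hq : q ∈ ctrs P) (aj a m2 : ℝ)
    {Λ : Finset ↥(boxDom (fun i => (ℓ + 1) * (Mh * P i)))} (hΛ : IsBlockUnion ℓ (fun i => Mh * P i) Λ)
    (h : ↥(Box d ℓ k (fun i => (ℓ + 1) * (Mh * P i))) → ℝ)
    (hh : ∀ z, h z ≠ 0 → ∃ x, emb ℓ k Mh P q hP hq x = z ∧ ¬ IL ℓ k Mh P q x) :
    Matrix.diagonal h * twoLevelOp ((ℓ + 1) ^ k) ℓ aj a m2 (fun i => Mh * P i) Λ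
      = Matrix.diagonal h * ((res (emb ℓ k Mh P q hP hq))ᵀ
          * twoLevelOp ((ℓ + 1) ^ k) ℓ aj a m2 (cubeM' Mh P q) (lamLoc ℓ Mh P q hP hq Λ) * res (emb ℓ k Mh P q hP hq)) := by
  ext z z'
  rw [Matrix.diagonal_mul, Matrix.diagonal_mul]
  by_cases hz : h z = 0
  · rw [hz, zero_mul, zero_mul]
  · obtain ⟨x, rfl, hx⟩ := hh z hz
    rw [row_eq_pad_row hℓ hP hq aj a m2 hΛ hx]

end Localisation

/-! ## §4 The printed cut-offs on `Ω` and on the cubes -/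

section Cutoffs

variable {ℓ k Mh : ℕ} {P : Fin (d + 1) → ℕ} {q : Fin (d + 1) → ℤ}

/-- `h_q` as a function on the sites of `Ω` (scale `M = L·M_h` unit blocks, mesh `L^{−k}`). [cite: Balaban1984PropagatorsII, (2.36) p.229] -/
def hΩ (ℓ k Mh : ℕ) (P : Fin (d + 1) → ℕ) (q : Fin (d + 1) → ℤ) (z : ↥(Box d ℓ k (fun i => (ℓ + 1) * (Mh * P i)))) : ℝ :=
  hq ((ℓ + 1) ^ k) ((ℓ + 1) * Mh) q z.1

/-- `h_q` seen from the cube `□_q` (local label `locLabel q ∈ {0,1}^{d+1}`). [cite: Balaban1984PropagatorsII, (2.36) p.229] -/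
def hLoc (ℓ k Mh : ℕ) (P : Fin (d + 1) → ℕ) (q : Fin (d + 1) → ℤ) (x : ↥(Box d ℓ k (fun i => (ℓ + 1) * cubeM' Mh P q i))) : ℝ :=
  hq ((ℓ + 1) ^ k) ((ℓ + 1) * Mh) (locLabel q) x.1

/-- `h_q ∘ emb = h_q^{loc}` (`B6Partition236TwoLevelBox.hq_shift`). [cite: Balaban1984PropagatorsII, (2.36) p.229] -/
theorem hΩ_emb (hMh : 1 ≤ Mh) (hP : ∀ i, 1 ≤ P i) (hq : q ∈ ctrs P)
    (x : ↥(Box d ℓ k (fun i => (ℓ + 1) * cubeM' Mh P q i))) :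
    hΩ ℓ k Mh P q (emb ℓ k Mh P q hP hq x) = hLoc ℓ k Mh P q x := by
  have hN : 1 ≤ (ℓ + 1) ^ k * ((ℓ + 1) * Mh) := Nat.one_le_iff_ne_zero.2 (by positivity)
  unfold hΩ hLoc
  rw [emb_val hP hq]
  exact hq_shift _ _ hN _ _

/-- `h_q ∘ emb = h_q^{loc}` as functions. [cite: Balaban1984PropagatorsII, (2.36) p.229] -/
theorem hΩ_comp_emb (hMh : 1 ≤ Mh) (hP : ∀ i, 1 ≤ P i) (hq : q ∈ ctrs P) :
    hΩ ℓ k Mh P q ∘ emb ℓ k Mh P q hP hq = hLoc ℓ k Mh P q :=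
  funext fun x => hΩ_emb hMh hP hq x

/-- `cubeLo + cubeW = min(q + 1, P)` (the upper end of the cut cube). [cite: Balaban1983RegularityDecay, §2 p.575] -/
theorem cubeLo_add_cubeW_eq (hP : ∀ i, 1 ≤ P i) (hq : q ∈ ctrs P) (i : Fin (d + 1)) :
    ((cubeLo q i + cubeW P q i : ℕ) : ℤ) = min (q i + 1) (P i) := by
  have h := (mem_ctrs.1 hq) i
  have hP' := hP i
  unfold cubeLo cubeW
  have e : ((q i).toNat : ℤ) = q i := Int.toNat_of_nonneg h.1
  have : (q i).toNat ≤ P i := by omega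
  by_cases hlt : (q i).toNat + 1 ≤ P i
  · rw [Nat.min_eq_left hlt, min_eq_left (by omega)]; omega
  · rw [Nat.min_eq_right (by omega), min_eq_right (by omega)]; omega

/-- `cubeLo = max(q − 1, 0)`. [cite: Balaban1983RegularityDecay, §2 p.575] -/
theorem cubeLo_eq (hq : q ∈ ctrs P) (i : Fin (d + 1)) : ((cubeLo q i : ℕ) : ℤ) = max (q i - 1) 0 := by
  have h := (mem_ctrs.1 hq) i
  unfold cubeLo
  have e : ((q i).toNat : ℤ) = q i := Int.toNat_of_nonneg h.1
  by_cases h0 : q i = 0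
  · rw [h0]; simp
  · rw [max_eq_left (by omega)]; omega

/-- **THE SUPPORT OF `h_q` LIES IN `□_q`** (its radius `⅝N` is less than the half-width `N`, `N ≥ 4`).
[cite: Balaban1984PropagatorsI, (1.118) p.36 («h ∈ C₀^∞(]−⅔,⅔[)»); Balaban1983RegularityDecay, §2 p.575] -/
theorem exists_emb_eq_of_hΩ_ne_zero (hℓ : 1 ≤ ℓ) (hk : 1 ≤ k) (hMh : 1 ≤ Mh) (hP : ∀ i, 1 ≤ P i) (hq : q ∈ ctrs P)
    {z : ↥(Box d ℓ k (fun i => (ℓ + 1) * (Mh * P i)))} (hz : hΩ ℓ k Mh P q z ≠ 0) :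
    ∃ x, emb ℓ k Mh P q hP hq x = z := by
  rw [emb, ← inSub_iff]
  set N : ℕ := (ℓ + 1) ^ k * ((ℓ + 1) * Mh) with hNdef
  have hN4 : 4 ≤ N := by
    have h2 : 2 ≤ (ℓ + 1) ^ k := by
      calc 2 = 2 ^ 1 := by norm_num
        _ ≤ (ℓ + 1) ^ 1 := Nat.pow_le_pow_left (by omega) 1
        _ ≤ (ℓ + 1) ^ k := Nat.pow_le_pow_right (by omega) hk
    have : 2 ≤ (ℓ + 1) * Mh := by nlinarith
    rw [hNdef]; nlinarith
  have hN1 : 1 ≤ N := le_trans (by norm_num) hN4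
  have hNr : (4 : ℝ) ≤ (N : ℝ) := by exact_mod_cast hN4
  have hzv := mem_boxDom.1 z.2
  intro i
  have hb := abs_lt_of_hq_ne_zero hN1 hz i
  rw [abs_lt] at hb
  simp only [B6Partition236TwoLevelBox.pos] at hb
  obtain ⟨hb1, hb2⟩ := hb
  obtain ⟨hz0, hz1⟩ := hzv i
  have hqi := (mem_ctrs.1 hq) i
  -- the image in fine coordinates: `N·cubeLo ≤ z_i < N·(cubeLo + cubeW)`
  have elo : (((ℓ + 1) ^ k : ℕ) : ℤ) * (cubeO ℓ Mh q i : ℤ) = (N : ℤ) * (cubeLo q i : ℤ) := by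
    simp only [cubeO, hNdef]; push_cast; ring
  have ehi : (((ℓ + 1) ^ k : ℕ) : ℤ) * ((cubeO ℓ Mh q i : ℤ) + (((ℓ + 1) * cubeM' Mh P q i : ℕ) : ℤ))
      = (N : ℤ) * ((cubeLo q i + cubeW P q i : ℕ) : ℤ) := by
    simp only [cubeO, cubeM', hNdef]; push_cast; ring
  rw [elo, ehi, cubeLo_add_cubeW_eq hP hq, cubeLo_eq hq]
  have hz1' : z.1 i < (N : ℤ) * (P i : ℤ) := by
    have : (((ℓ + 1) ^ k * ((ℓ + 1) * (Mh * P i)) : ℕ) : ℤ) = (N : ℤ) * (P i : ℤ) := by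
      rw [hNdef]; push_cast; ring
    rw [← this]; exact_mod_cast hz1
  have hNz : (0 : ℤ) < N := by exact_mod_cast hN1
  constructor
  · -- lower end
    rcases le_or_gt (q i) 0 with hq0 | hq0
    · have : q i = 0 := le_antisymm hq0 hqi.1
      rw [this]; simp; exact hz0
    · rw [max_eq_left (by omega)]
      -- `z_i > Nq_i − ⅝N − ½ ≥ N(q_i − 1)` since `⅜N ≥ ½`
      have hr : ((N : ℤ) * (q i - 1) : ℝ) < ((z.1 i : ℤ) : ℝ) := by
        push_cast; nlinarith
      have : (N : ℤ) * (q i - 1) < z.1 i := by exact_mod_cast hr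
      exact this.le
  · -- upper end
    rcases le_or_gt (P i : ℤ) (q i + 1) with hqP | hqP
    · rw [min_eq_right hqP]; exact hz1'
    · rw [min_eq_left hqP.le]
      have hr : ((z.1 i : ℤ) : ℝ) < ((N : ℤ) * (q i + 1) : ℝ) := by
        push_cast; nlinarith
      exact_mod_cast hr

/-- **`h_q` VANISHES ON THE INTERNAL LAYER OF `□_q`** (`B6Partition236TwoLevelBox.hloc_eq_zero_low/high`).
[cite: Balaban1983RegularityDecay, (2.6) p.576 («h_j can be ≠ 0 only on the part of the boundary of □_j which is contained in the boundary of Ω»)] -/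
theorem hLoc_eq_zero_of_IL (hℓ : 1 ≤ ℓ) (hk : 1 ≤ k) (hMh : 1 ≤ Mh) (hP : ∀ i, 1 ≤ P i) (hq : q ∈ ctrs P)
    {x : ↥(Box d ℓ k (fun i => (ℓ + 1) * cubeM' Mh P q i))} (hx : IL ℓ k Mh P q x) : hLoc ℓ k Mh P q x = 0 := by
  set N : ℕ := (ℓ + 1) ^ k * ((ℓ + 1) * Mh) with hNdef
  have hN4 : 4 ≤ N := by
    have h2 : 2 ≤ (ℓ + 1) ^ k := by
      calc 2 = 2 ^ 1 := by norm_num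
        _ ≤ (ℓ + 1) ^ 1 := Nat.pow_le_pow_left (by omega) 1
        _ ≤ (ℓ + 1) ^ k := Nat.pow_le_pow_right (by omega) hk
    have : 2 ≤ (ℓ + 1) * Mh := by nlinarith
    rw [hNdef]; nlinarith
  obtain ⟨i, ⟨hx0, hlo⟩ | ⟨hxt, hhi⟩⟩ := hx
  · -- lower internal face: local label 1
    have hqi := (mem_ctrs.1 hq) i
    have hc : locLabel q i = 1 := by
      unfold locLabel; unfold cubeLo at hlo ⊢
      have e : ((q i).toNat : ℤ) = q i := Int.toNat_of_nonneg hqi.1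
      omega
    exact hloc_eq_zero_low hN4 hc (le_of_eq hx0.symm) (by rw [hx0]; norm_num)
  · -- upper internal face: width = label + 1
    obtain ⟨hc, hw⟩ := cubeW_cases hP hq i
    have hw' : (cubeW P q i : ℤ) = locLabel q i + 1 := by
      rcases hw with hw | ⟨hw, hc1⟩
      · exact hw
      · exfalso
        have hqi := (mem_ctrs.1 hq) i
        have hP' := hP i
        simp only [locLabel, cubeW, cubeLo] at hc1 hhi hw
        have e : ((q i).toNat : ℤ) = q i := Int.toNat_of_nonneg hqi.1
        omega
    refine hloc_eq_zero_high (M := (ℓ + 1) * Mh) (w := fun j => cubeW P q j) hN4 hw' (z := x.1) ?_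
    have : (((ℓ + 1) ^ k * ((ℓ + 1) * cubeM' Mh P q i) : ℕ) : ℤ) = ((N * cubeW P q i : ℕ) : ℤ) := by
      rw [hNdef]; simp only [cubeM']; push_cast; ring
    rw [← this]; omega

/-- the support condition of `diagonal_mul_eq_pad` for `h_q`. [cite: Balaban1983RegularityDecay, (2.6) p.576] -/
theorem hΩ_support (hℓ : 1 ≤ ℓ) (hk : 1 ≤ k) (hMh : 1 ≤ Mh) (hP : ∀ i, 1 ≤ P i) (hq : q ∈ ctrs P)
    (z : ↥(Box d ℓ k (fun i => (ℓ + 1) * (Mh * P i)))) (hz : hΩ ℓ k Mh P q z ≠ 0) :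
    ∃ x, emb ℓ k Mh P q hP hq x = z ∧ ¬ IL ℓ k Mh P q x := by
  obtain ⟨x, rfl⟩ := exists_emb_eq_of_hΩ_ne_zero hℓ hk hMh hP hq hz
  refine ⟨x, rfl, fun hx => hz ?_⟩
  rw [hΩ_emb hMh hP hq, hLoc_eq_zero_of_IL hℓ hk hMh hP hq hx]

end Cutoffs

/-! ## §5 (2.37)–(2.38) for the genuine two-level operator -/

section Assembly

variable (ℓ k Mh : ℕ) (P : Fin (d + 1) → ℕ) (aj a m2 : ℝ) (Λ : Finset ↥(boxDom (fun i : Fin (d + 1) => (ℓ + 1) * (Mh * P i))))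
  (hP : ∀ i, 1 ≤ P i)

/-- the cube operator `E_q = Δ_{□_q}^{L^{−j},N} + m² + Q′*aQ′↾_{□_q}` (`B6Ineq243TwoLevelBox.twoLevelOp` of the cut cube).
[cite: Balaban1984PropagatorsII, (2.37) p.229 («G′(□) is an inverse of the operator Δ′_a with … Neumann boundary conditions»)] -/
def cubeOp (q : ↥(ctrs P)) :=
  twoLevelOp ((ℓ + 1) ^ k) ℓ aj a m2 (cubeM' Mh P q.1) (lamLoc ℓ Mh P q.1 hP q.2 Λ)

/-- the cube propagator `G′(□_q)` (`B6Ineq243TwoLevelBox.gTwoLevel` of the cut cube). [cite: Balaban1984PropagatorsII, (2.37), (2.42) pp.229–230] -/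
def cubeG (q : ↥(ctrs P)) :=
  gTwoLevel ((ℓ + 1) ^ k) ℓ aj a m2 (cubeM' Mh P q.1) (lamLoc ℓ Mh P q.1 hP q.2 Λ)

/-- `h_□ ↦` the multiplication operator `diagonal h_q` on `Ω`. [cite: Balaban1984PropagatorsII, (2.36)–(2.37) p.229] -/
def hDiag (q : ↥(ctrs P)) :
    Matrix ↥(Box d ℓ k (fun i => (ℓ + 1) * (Mh * P i))) ↥(Box d ℓ k (fun i => (ℓ + 1) * (Mh * P i))) ℝ :=
  Matrix.diagonal (hΩ ℓ k Mh P q.1)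

/-- `G′(□) ↦` the padded cube propagator `resᵀ·G′(□_q)·res` on `Ω`. [cite: Balaban1984PropagatorsII, (2.37) p.229] -/
def gPad (q : ↥(ctrs P)) :
    Matrix ↥(Box d ℓ k (fun i => (ℓ + 1) * (Mh * P i))) ↥(Box d ℓ k (fun i => (ℓ + 1) * (Mh * P i))) ℝ :=
  (res (emb ℓ k Mh P q.1 hP q.2))ᵀ * cubeG ℓ k Mh P aj a m2 Λ hP q * res (emb ℓ k Mh P q.1 hP q.2)

/-- **THE LOCAL (2.44)-OPERATOR OF THE CUBE**, padded: `resᵀ·K_q(h_q)G′(□_q)h_q·res` with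
`K_q(h) = B6Ineq243TwoLevelBox.kComm E_q h` — the object estimated by `B6Ineq243TwoLevelBox.ineq244_twoLevel`.
[cite: Balaban1984PropagatorsII, (2.38) p.229, (2.44) p.230] -/
def bPad (q : ↥(ctrs P)) :
    Matrix ↥(Box d ℓ k (fun i => (ℓ + 1) * (Mh * P i))) ↥(Box d ℓ k (fun i => (ℓ + 1) * (Mh * P i))) ℝ :=
  (res (emb ℓ k Mh P q.1 hP q.2))ᵀ
    * (kComm (cubeOp ℓ k Mh P aj a m2 Λ hP q) (hLoc ℓ k Mh P q.1) * cubeG ℓ k Mh P aj a m2 Λ hP q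
        * Matrix.diagonal (hLoc ℓ k Mh P q.1))
    * res (emb ℓ k Mh P q.1 hP q.2)

variable {ℓ k Mh P aj a m2 Λ hP}

/-- **(2.36) IN THE MATRIX RING**: `Σ_q (diagonal h_q)² = 1`. [cite: Balaban1984PropagatorsII, (2.36) p.229] -/
theorem sum_hDiag_sq (hMh : 1 ≤ Mh) :
    ∑ q : ↥(ctrs P), hDiag ℓ k Mh P q * hDiag ℓ k Mh P q = 1 := by
  have hN1 : 1 ≤ (ℓ + 1) ^ k * ((ℓ + 1) * Mh) := Nat.one_le_iff_ne_zero.2 (by positivity)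
  ext z z'
  rw [Matrix.sum_apply]
  simp only [hDiag, Matrix.diagonal_mul_diagonal, Matrix.diagonal_apply, Matrix.one_apply]
  by_cases hzz : z = z'
  · subst hzz
    simp only [if_true]
    rw [Finset.sum_coe_sort (ctrs P) (fun q => hΩ ℓ k Mh P q z * hΩ ℓ k Mh P q z)]
    have := sum_hq_sq hN1 (P := P) (S := fun i => (ℓ + 1) ^ k * ((ℓ + 1) * (Mh * P i)))
      (fun i => by ring) z.2
    simpa only [hΩ, sq] using this
  · simp [hzz]

/-- **THE LOCAL-INVERSE PROPERTY**: `h_q·E·(resᵀG′(□_q)res)·h_q = h_q²` — `G′(□_q)` inverts `Δ′_a` on the support of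
`h_q` (localisation + `E_qG′(□_q) = 1` + `res·resᵀ = 1`). [cite: Balaban1984PropagatorsII, (2.37)–(2.38) p.229] -/
theorem hloc_cube (hℓ : 1 ≤ ℓ) (hk : 1 ≤ k) (hMh : 1 ≤ Mh) (haj : 0 < aj) (ha : 0 < a) (hm : 0 ≤ m2)
    (hΛ : IsBlockUnion ℓ (fun i => Mh * P i) Λ) (q : ↥(ctrs P)) :
    hDiag ℓ k Mh P q * twoLevelOp ((ℓ + 1) ^ k) ℓ aj a m2 (fun i => Mh * P i) Λ * gPad ℓ k Mh P aj a m2 Λ hP q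
        * hDiag ℓ k Mh P q = hDiag ℓ k Mh P q * hDiag ℓ k Mh P q := by
  have hn1 : 1 ≤ (ℓ + 1) ^ k := Nat.one_le_pow _ _ (by omega)
  have hinj := emb_injective (ℓ := ℓ) (k := k) (Mh := Mh) hP q.2
  have hM' : ∀ i, 1 ≤ cubeM' Mh P q.1 i := fun i =>
    Nat.one_le_iff_ne_zero.2 (Nat.mul_ne_zero_iff.2 ⟨by omega, by have := (one_le_cubeW hP q.2 i).1; omega⟩)
  have hEG : cubeOp ℓ k Mh P aj a m2 Λ hP q * cubeG ℓ k Mh P aj a m2 Λ hP q = 1 :=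
    twoLevelOp_mul_gTwoLevel hn1 hℓ haj ha hm hM' (isBlockUnion_lamLoc hP q.2 hΛ)
  unfold hDiag gPad
  rw [diagonal_mul_eq_pad hℓ hP q.2 aj a m2 hΛ _ (hΩ_support hℓ hk hMh hP q.2)]
  -- `h resᵀ E_q res resᵀ G res h = h resᵀ (E_q G) res h = h resᵀ res h = h h`
  have e : Matrix.diagonal (hΩ ℓ k Mh P q.1)
        * ((res (emb ℓ k Mh P q.1 hP q.2))ᵀ * twoLevelOp ((ℓ + 1) ^ k) ℓ aj a m2 (cubeM' Mh P q.1)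
            (lamLoc ℓ Mh P q.1 hP q.2 Λ) * res (emb ℓ k Mh P q.1 hP q.2))
        * ((res (emb ℓ k Mh P q.1 hP q.2))ᵀ * cubeG ℓ k Mh P aj a m2 Λ hP q * res (emb ℓ k Mh P q.1 hP q.2))
      = Matrix.diagonal (hΩ ℓ k Mh P q.1) * ((res (emb ℓ k Mh P q.1 hP q.2))ᵀ
          * (cubeOp ℓ k Mh P aj a m2 Λ hP q * (res (emb ℓ k Mh P q.1 hP q.2) * (res (emb ℓ k Mh P q.1 hP q.2))ᵀ)
            * cubeG ℓ k Mh P aj a m2 Λ hP q) * res (emb ℓ k Mh P q.1 hP q.2)) := by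
    simp only [cubeOp, Matrix.mul_assoc]
  rw [e, res_mul_transpose_res hinj, Matrix.mul_one, hEG, Matrix.mul_one,
    diagonal_mul_transpose_res_mul_res hinj _ (fun z hz => exists_emb_eq_of_hΩ_ne_zero hℓ hk hMh hP q.2 hz)]

/-- **[B6] (2.37)–(2.38) FOR THE GENUINE TWO-LEVEL OPERATOR ON A BOX**: with `G′₀ = Σ_q h_qG′(□_q)h_q`
(`B6Eq250.gZero hDiag gPad`) and `R = Σ_q K(h_q)G′(□_q)h_q` (`B6Eq250.rOp`), `Δ′_aG′₀ = I − R` — the abstract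
`B6Eq250.eq238` with its two hypotheses ((2.36) and the local-inverse property) DISCHARGED for `Δ′_a = twoLevelOp` on
the box `Ω`, the printed cut-offs and the genuine cube propagators; for every `ℓ, k, M_h ≥ 1`, window point and block
union `Λ`. [cite: Balaban1984PropagatorsII, (2.37)–(2.38) p.229] -/
theorem eq238_twoLevelBox (hℓ : 1 ≤ ℓ) (hk : 1 ≤ k) (hMh : 1 ≤ Mh) (haj : 0 < aj) (ha : 0 < a) (hm : 0 ≤ m2)
    (hΛ : IsBlockUnion ℓ (fun i => Mh * P i) Λ) :
    twoLevelOp ((ℓ + 1) ^ k) ℓ aj a m2 (fun i => Mh * P i) Λ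
        * B6Eq250.gZero (hDiag ℓ k Mh P) (gPad ℓ k Mh P aj a m2 Λ hP)
      = 1 - B6Eq250.rOp (twoLevelOp ((ℓ + 1) ^ k) ℓ aj a m2 (fun i => Mh * P i) Λ)
          (hDiag ℓ k Mh P) (gPad ℓ k Mh P aj a m2 Λ hP) :=
  B6Eq250.eq238 _ _ _ (sum_hDiag_sq hMh) (hloc_cube hℓ hk hMh haj ha hm hΛ)

/-- the two-level operator is a symmetric matrix. [cite: Balaban1984PropagatorsII, (2.13)–(2.14) p.225 (a quadratic form)] -/
theorem twoLevelOp_isSymm (n ℓ' : ℕ) (aj' a' m2' : ℝ) (M' : Fin (d + 1) → ℕ)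
    (Λ' : Finset ↥(boxDom (fun i => (ℓ' + 1) * M' i))) : (twoLevelOp n ℓ' aj' a' m2' M' Λ').IsSymm := by
  unfold twoLevelOp
  refine (boxOpR_isSymm n aj' m2' _).sub ?_
  unfold Matrix.IsSymm
  rw [Matrix.transpose_smul, Matrix.transpose_mul, Matrix.transpose_mul, Matrix.transpose_transpose,
    Matrix.transpose_sub, Matrix.transpose_smul, Matrix.transpose_smul, Matrix.transpose_one, ← Matrix.mul_assoc]
  congr 3
  unfold projΛ
  rw [Matrix.transpose_submatrix, (blockAvgP_isSymm ℓ' M').eq]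

/-- **EACH TERM OF `R` IS THE PADDED LOCAL (2.44)-OPERATOR**: `K(h_q)·(resᵀG′(□_q)res)·h_q = resᵀ·K_q(h_q)G′(□_q)h_q·res`
with the LOCAL commutator `K_q(h) = hE_q − E_qh` of the cube (`B6Ineq243TwoLevelBox.kComm`) — by the localisation
`h_qE = h_qresᵀE_q res` and its transpose (`E`, `E_q` symmetric). [cite: Balaban1984PropagatorsII, (2.38) p.229, (2.44) p.230] -/
theorem bTerm_eq_bPad (hℓ : 1 ≤ ℓ) (hk : 1 ≤ k) (hMh : 1 ≤ Mh)
    (hΛ : IsBlockUnion ℓ (fun i => Mh * P i) Λ) (q : ↥(ctrs P)) :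
    B6Eq250.kOp (twoLevelOp ((ℓ + 1) ^ k) ℓ aj a m2 (fun i => Mh * P i) Λ) (hDiag ℓ k Mh P q)
        * gPad ℓ k Mh P aj a m2 Λ hP q * hDiag ℓ k Mh P q = bPad ℓ k Mh P aj a m2 Λ hP q := by
  have hinj := emb_injective (ℓ := ℓ) (k := k) (Mh := Mh) hP q.2
  have hloc1 := diagonal_mul_eq_pad hℓ hP q.2 aj a m2 hΛ _ (hΩ_support hℓ hk hMh hP q.2)
  have hEsym := (twoLevelOp_isSymm ((ℓ + 1) ^ k) ℓ aj a m2 (fun i => Mh * P i) Λ).eq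
  have hEqsym := (twoLevelOp_isSymm ((ℓ + 1) ^ k) ℓ aj a m2 (cubeM' Mh P q.1) (lamLoc ℓ Mh P q.1 hP q.2 Λ)).eq
  unfold bPad gPad hDiag cubeOp
  rw [B6Eq250.kOp_def, kComm, ← hΩ_comp_emb hMh hP q.2]
  exact kOp_pad_eq hinj _ _ _ _ hloc1 hEsym hEqsym

/-- **(2.38) WITH `R` AS THE SUM OF THE PADDED LOCAL OPERATORS**: `Δ′_aG′₀ = 1 − Σ_q resᵀ·K_q(h_q)G′(□_q)h_q·res`.
[cite: Balaban1984PropagatorsII, (2.38) p.229] -/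
theorem eq238_twoLevelBox_bPad (hℓ : 1 ≤ ℓ) (hk : 1 ≤ k) (hMh : 1 ≤ Mh) (haj : 0 < aj) (ha : 0 < a) (hm : 0 ≤ m2)
    (hΛ : IsBlockUnion ℓ (fun i => Mh * P i) Λ) :
    twoLevelOp ((ℓ + 1) ^ k) ℓ aj a m2 (fun i => Mh * P i) Λ
        * B6Eq250.gZero (hDiag ℓ k Mh P) (gPad ℓ k Mh P aj a m2 Λ hP)
      = 1 - ∑ q : ↥(ctrs P), bPad ℓ k Mh P aj a m2 Λ hP q := by
  rw [eq238_twoLevelBox hℓ hk hMh haj ha hm hΛ, B6Eq250.rOp_eq_sum_bTerm]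
  refine congrArg (fun T => (1 : Matrix _ _ ℝ) - T) (Finset.sum_congr rfl fun q _ => ?_)
  rw [B6Eq250.bTerm_apply]
  exact bTerm_eq_bPad hℓ hk hMh hΛ q

end Assembly

end

end Literature.MathematicalPhysics.QuantumFieldTheory.Balaban1983to89.B6Eq238TwoLevelBox
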